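import Mathlib
import HarnessLib
import HarnessLib.Audit
import Summits.RiemannHypothesis.Statement
import Literature.NumberTheory.LFunctions.WeilExplicit
import Literature.NumberTheory.LFunctions.UniformWeilPositivityRH
import Literature.NumberTheory.LFunctions.WeilGroundEnergyProofs

/-!
# Theses-free copies of the route propositions of route `WeilWindowFlow` (build refactor)

This module restates, as plain `def … : Prop` with the SAME terms, every statement item of the route file
`Summits/RiemannHypothesis/RiemannHypothesis/Theses/WeilWindowFlow.lean` (namespace
`Summit.RiemannHypothesis.RiemannHypothesis.Theses.WeilWindowFlow`), in the namespace
`Summit.RiemannHypothesis.RiemannHypothesis.Theorems.WeilRouteProps.WeilWindowFlow` (the route's deciding theorem `closes` is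
deliberately NOT copied — gate5 ruling 2026-08-26T22:17Z).

WHY (21-frontier standing build rule 2026-08-26T18:52:29Z; director-rh BRIEF-weil-import-refactor): only LEAF modules
(closers nobody imports) may import a `Theses` (route) file, so that a route edit invalidates a few dozen leaves instead of
the ≈3 000-module cone that used to hang below the route file. Towers, certificate shards and libraries that need to
MENTION a route proposition (as a hypothesis or in a type) import this module instead; it imports exactly what the route
file imports and never a `Theses` file.

Each copy is definitionally equal to the route declaration (same term); the leaf
`Theorems/WeilRouteProps/WeilWindowFlowIff.lean` records `Theorems.WeilRouteProps.WeilWindowFlow.X ↔ Theses.WeilWindowFlow.X` by `Iff.rfl` for every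
item `X`, so a closer proves the route declaration from a tower theorem about the copy by `exact` (definitional unfolding)
or through that `Iff`. These definitions are NOT route items (no `@[route_item]`), carry no status, and must be kept
textually in sync with the route file if a statement is ever restated (the `Iff.rfl` leaf then fails loudly).
Nothing here bears on the truth of RH.
-/

namespace Summit.RiemannHypothesis.RiemannHypothesis.Theorems.WeilRouteProps.WeilWindowFlow

open scoped BigOperators Topology Manifold Classical MeasureTheory ProbabilityTheory Matrix InnerProductSpace ComplexConjugate ContinuousMap
open Filter Set Function TopologicalSpace MeasureTheory
open Summit

/-- Theses-free copy (build refactor) of the route proposition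
`Summit.RiemannHypothesis.RiemannHypothesis.Theses.WeilWindowFlow.GronwallLeakage` (item stmt-RiemannHypothesis-1037, crux): the same term, hence
definitionally equal to it (`WeilRouteProps.WeilWindowFlowIff`). Not a route item; see the route file for the informal statement,
status and sources. -/
def GronwallLeakage : Prop :=
  ∃ C : ℝ → ℝ, ∀ b a : ℝ, 0 < b → b ≤ a → IntervalIntegrable C volume b a ∧ Literature.NumberTheory.LFunctions.weilGroundEnergy b * Real.exp (-(∫ x in b..a, C x)) ≤ Literature.NumberTheory.LFunctions.weilGroundEnergy a

/-- Theses-free copy (build refactor) of the route proposition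
`Summit.RiemannHypothesis.RiemannHypothesis.Theses.WeilWindowFlow.DiniLeakage` (item stmt-RiemannHypothesis-1038, crux): the same term, hence
definitionally equal to it (`WeilRouteProps.WeilWindowFlowIff`). Not a route item; see the route file for the informal statement,
status and sources. -/
def DiniLeakage : Prop :=
  ∀ b₀ A : ℝ, 0 < b₀ → b₀ ≤ A → ∃ K : ℝ, ∀ a : ℝ, b₀ ≤ a → a ≤ A → ∀ η δ : ℝ, 0 < η → 0 < δ → ∃ h : ℝ, 0 < h ∧ h < δ ∧ Literature.NumberTheory.LFunctions.weilGroundEnergy a - Literature.NumberTheory.LFunctions.weilGroundEnergy (a + h) ≤ h * (K * Literature.NumberTheory.LFunctions.weilGroundEnergy a + η)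

/-- Theses-free copy (build refactor) of the route proposition
`Summit.RiemannHypothesis.RiemannHypothesis.Theses.WeilWindowFlow.WindowLipschitz` (item stmt-RiemannHypothesis-1039, crux): the same term, hence
definitionally equal to it (`WeilRouteProps.WeilWindowFlowIff`). Not a route item; see the route file for the informal statement,
status and sources. -/
def WindowLipschitz : Prop :=
  ∀ b₀ A : ℝ, 0 < b₀ → b₀ ≤ A → ∃ L : ℝ, ∀ b a : ℝ, b₀ ≤ b → b ≤ a → a ≤ A → Literature.NumberTheory.LFunctions.weilGroundEnergy b - Literature.NumberTheory.LFunctions.weilGroundEnergy a ≤ L * (a - b)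

/-- Theses-free copy (build refactor) of the route proposition
`Summit.RiemannHypothesis.RiemannHypothesis.Theses.WeilWindowFlow.DerivLeakage` (item stmt-RiemannHypothesis-14754, crux): the same term, hence
definitionally equal to it (`WeilRouteProps.WeilWindowFlowIff`). Not a route item; see the route file for the informal statement,
status and sources. -/
def DerivLeakage : Prop :=
  ∀ b₀ A : ℝ, 0 < b₀ → b₀ ≤ A → ∃ K : ℝ, ∀ a : ℝ, b₀ ≤ a → a ≤ A → 0 < Literature.NumberTheory.LFunctions.weilGroundEnergy a → DifferentiableAt ℝ Literature.NumberTheory.LFunctions.weilGroundEnergy a → -deriv Literature.NumberTheory.LFunctions.weilGroundEnergy a ≤ K * Literature.NumberTheory.LFunctions.weilGroundEnergy a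

/-- Theses-free copy (build refactor) of the route proposition
`Summit.RiemannHypothesis.RiemannHypothesis.Theses.WeilWindowFlow.PrimeTwoWindow` (item stmt-RiemannHypothesis-1040, support): the same term, hence
definitionally equal to it (`WeilRouteProps.WeilWindowFlowIff`). Not a route item; see the route file for the informal statement,
status and sources. -/
def PrimeTwoWindow : Prop :=
  ∃ a : ℝ, Real.log 2 / 2 < a ∧ Literature.NumberTheory.LFunctions.WeilPositivityOn a

/-- Theses-free copy (build refactor) of the route proposition
`Summit.RiemannHypothesis.RiemannHypothesis.Theses.WeilWindowFlow.WindowContinuity` (item stmt-RiemannHypothesis-1041, support): the same term, hence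
definitionally equal to it (`WeilRouteProps.WeilWindowFlowIff`). Not a route item; see the route file for the informal statement,
status and sources. -/
def WindowContinuity : Prop :=
  ∀ a : ℝ, 0 < a → ContinuousAt Literature.NumberTheory.LFunctions.weilGroundEnergy a

/-- Theses-free copy (build refactor) of the route proposition
`Summit.RiemannHypothesis.RiemannHypothesis.Theses.WeilWindowFlow.StrictArchimedeanBottom` (item stmt-RiemannHypothesis-1042, support): the same term, hence
definitionally equal to it (`WeilRouteProps.WeilWindowFlowIff`). Not a route item; see the route file for the informal statement,
status and sources. -/
def StrictArchimedeanBottom : Prop :=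
  0 < Literature.NumberTheory.LFunctions.weilGroundEnergy (Real.log 2 / 2)

/-- Theses-free copy (build refactor) of the route proposition
`Summit.RiemannHypothesis.RiemannHypothesis.Theses.WeilWindowFlow.StrictUnderRH` (item stmt-RiemannHypothesis-1043, support): the same term, hence
definitionally equal to it (`WeilRouteProps.WeilWindowFlowIff`). Not a route item; see the route file for the informal statement,
status and sources. -/
def StrictUnderRH : Prop :=
  Summit.RiemannHypothesis → ∀ a : ℝ, 0 < a → 0 < Literature.NumberTheory.LFunctions.weilGroundEnergy a

/-- Theses-free copy (build refactor) of the route proposition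
`Summit.RiemannHypothesis.RiemannHypothesis.Theses.WeilWindowFlow.DiniGlue` (item stmt-RiemannHypothesis-1044, support): the same term, hence
definitionally equal to it (`WeilRouteProps.WeilWindowFlowIff`). Not a route item; see the route file for the informal statement,
status and sources. -/
def DiniGlue : Prop :=
  DiniLeakage → WindowContinuity → GronwallLeakage

/-- Theses-free copy (build refactor) of the route proposition
`Summit.RiemannHypothesis.RiemannHypothesis.Theses.WeilWindowFlow.LipschitzDerivGlue` (item stmt-RiemannHypothesis-14755, support): the same term, hence
definitionally equal to it (`WeilRouteProps.WeilWindowFlowIff`). Not a route item; see the route file for the informal statement,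
status and sources. -/
def LipschitzDerivGlue : Prop :=
  WindowLipschitz → DerivLeakage → DiniLeakage

/-- Theses-free copy (build refactor) of the route proposition
`Summit.RiemannHypothesis.RiemannHypothesis.Theses.WeilWindowFlow.Assembly` (item stmt-RiemannHypothesis-1045, assembly): the same term, hence
definitionally equal to it (`WeilRouteProps.WeilWindowFlowIff`). Not a route item; see the route file for the informal statement,
status and sources. -/
def Assembly : Prop :=
  GronwallLeakage → Summit.RiemannHypothesis

end Summit.RiemannHypothesis.RiemannHypothesis.Theorems.WeilRouteProps.WeilWindowFlow
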